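import Literature.Geometry.Kaehler.ComplexTorusAnalyticIteratedIntersectionBezoutEquality
import Literature.Geometry.Kaehler.AnalyticSetFiniteIntersection
import HarnessLib

/-!
# Excess components of an iterated intersection `Y ∩ ⋂_j (D_j − τ_j)`: every component has dimension at
# least the expected one, properness means "no excess component", every component of the Fulton cycle is a
# proper component or lies in an excess component; the static case `τ = 0`

Layer `Literature/Geometry/Kaehler`; lane `lit-hodgefound`, seat p07, programme «INTERSECTION NUMBERS ARE
POINT COUNTS», file 22. Let `X = E/Λ` be a compact complex torus of dimension `g`, `Y ⊆ X` closed analytic of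
pure dimension `d = r + 1 + k`, `D₀, …, D_{k−1}` closed analytic hypersurfaces, `τ ∈ X^k` arbitrary,
`Z(τ) = Y ∩ ⋂_j (D_j − τ_j)`. By [Chirka1989, §3.5 Prop. 3 / §12.1] ("the codimension of `A₁ ∩ ⋯ ∩ A_k` at
each point does not exceed the sum of the codimensions", tree: `AnalyticSetFiniteIntersection`) every
irreducible component of `Z(τ)` has dimension `≥ r + 1`; the PROPER components are those of dimension exactly
`r + 1` [Fulton1998, Def. 7.1], the others are EXCESS components. Files 18–20 constructed the effective
Fulton cycle `R` (`class = cl(R)`, `|R| ⊆ Z(τ)`) and showed that the proper components are components of `R`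
with multiplicity `≥ 1`. This file adds:

* §1 dimension theory of `Z(τ)` (public API): `codim_le_of_isRegularPointOfCodim_inter_iInter_translate`
  (every regular point of `Z(τ)` has codimension `≤ codim Y + k`),
  `exists_hasPureDim_of_isIrreducibleComponent_inter_iInter_translate` (every component has pure dimension
  `m` with `r + 1 ≤ m`), `hasPureDim_of_forall_isIrreducibleComponent` (a non-empty closed analytic set all of
  whose components have pure dimension `m` has pure dimension `m`), and the PROPERNESS CRITERION
  **`inter_iInter_translate_eq_empty_or_hasPureDim_iff_forall_isIrreducibleComponent`**: `Z(τ)` is proper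
  (empty or of pure dimension `r + 1`) iff it has no excess component;
* §2 structure of the Fulton cycle [Fulton1998, §12.2: "each irreducible component of `⋂ V_i` appears as a
  distinguished variety"; §6.1: distinguished varieties lie in the components of the intersection]:
  **`exists_effectiveCycle_smul_wedge_wedgeFamily_eq_chainCycleClass_forall_mult_ne_zero`** — every component
  `W` of `R` is EITHER a proper component of `Z(τ)` OR is contained in an excess component of `Z(τ)` (of pure
  dimension `> r + 1`); if `Z(τ)` has no excess component then `|R| = Z(τ)` and the components of `R` are
  exactly the components of `Z(τ)`;
* §3 the static case `τ = 0` of files 19–20 and of §1 (translate-free statements about `Y ∩ ⋂_j D_j`):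
  dimension bound, `#{proper components of Y ∩ ⋂_j D_j} ≤ (L^{r+1} · Y · D₀ ⋯ D_{k−1})`, and the equality case.

> [Chirka1989, §3.5 Prop. 3 (p. 37), §12.1 (p. 136), §5.4 Thm. (p. 57)]; [Fulton1998, §7.1 Def. 7.1,
> Prop. 7.1 (a) (p. 119–120), §8.4 (1) and Example 8.4.6 (p. 145, 148), §12.2 Cor. 12.2 (a) and
> Example 12.2.1 (a) (p. 212–213)].

Theorems only; no definitions, no named facts.

## References

* [Chirka1989] E. M. Chirka, *Complex Analytic Sets*, Kluwer 1989, §3.5, §5.4, §12.1.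
* [Fulton1998] W. Fulton, *Intersection Theory*, 2nd ed., Springer 1998, §7.1, §8.4, §12.2.
* [deJong1993AmpleLineBundles] J. de Jong (ed.), *Ample line bundles and intersection theory*, in:
  Diophantine Approximation and Abelian Varieties, LNM 1566, Springer 1993, Ch. VII §4 Thm. 4.3.1.
* [Lange2023AbelianVarietiesComplex] H. Lange, *Abelian Varieties over the Complex Numbers*, Springer 2023,
  §4.6.2 p. 235.
-/

noncomputable section

open scoped Manifold Topology Pointwise
open MeasureTheory Set Function Filter Module
open Literature.LinearAlgebra.Alternating

namespace Literature.Geometry.Kaehler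
namespace ComplexTorus

universe u

variable {ι : Type*} [Fintype ι] [DecidableEq ι] {E : Type u} [NormedAddCommGroup E] [InnerProductSpace ℂ E]
  [FiniteDimensional ℂ E] [MeasurableSpace E] [BorelSpace E] (Φ : (ι → ℝ) ≃L[ℝ] E) {n : ℕ} (e : Fin n ≃ ι)

omit [Fintype ι] [DecidableEq ι] [FiniteDimensional ℂ E] [MeasurableSpace E] [BorelSpace E] in
/-- The member at `τ = 0` is the static intersection `Y ∩ ⋂_j D_j`. [folklore] -/
private theorem inter_iInter_translate_zero₂₂ {k : ℕ} (Y : Set (ComplexTorus Φ))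
    (D : Fin k → Set (ComplexTorus Φ)) :
    Y ∩ ⋂ j, (fun x ↦ x + (0 : Fin k → ComplexTorus Φ) j) ⁻¹' D j = Y ∩ ⋂ j, D j := by
  simp only [Pi.zero_apply, add_zero, preimage_id']

/-! ### §1 Every component of `Z(τ)` has dimension `≥ r + 1`; properness means "no excess component" -/

omit [DecidableEq ι] [MeasurableSpace E] [BorelSpace E] in
/-- **`codim_x Z(τ) ≤ codim Y + k` at every point**: for `Y` closed analytic of pure dimension `d`, closed
analytic hypersurfaces `D_j` (pure dimension `q = g − 1`) and any `τ`, every regular point of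
`Z(τ) = Y ∩ ⋂_j (D_j − τ_j)` has codimension `c` with `c + d ≤ g + k`, i.e. `dim ≥ d − k` ("the codimension of
`A₁ ∩ ⋯ ∩ A_k` at each point does not exceed the sum of the codimensions").
[cite: Chirka1989, §3.5 Prop. 3 (p. 37) and §12.1 (p. 136)] -/
theorem codim_le_of_isRegularPointOfCodim_inter_iInter_translate {q : ℕ} (hq1 : q + 1 = finrank ℂ E)
    {k d : ℕ} {Y : Set (ComplexTorus Φ)} (hY : HasPureDim 𝓘(ℂ, E) Y d)
    {D : Fin k → Set (ComplexTorus Φ)} (hD : ∀ j, HasPureDim 𝓘(ℂ, E) (D j) q) (τ : Fin k → ComplexTorus Φ)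
    {y : ComplexTorus Φ} (hy : y ∈ Y ∩ ⋂ j, (fun x ↦ x + τ j) ⁻¹' D j) {c : ℕ}
    (hc : IsRegularPointOfCodim 𝓘(ℂ, E) (Y ∩ ⋂ j, (fun x ↦ x + τ j) ⁻¹' D j) c y) :
    c + d ≤ finrank ℂ E + k := by
  classical
  obtain ⟨cY, hcY, hYc⟩ := hY
  -- the family `Y, D₀ − τ₀, …, D_{k−1} − τ_{k−1}` over `Option (Fin k)`
  set F : Option (Fin k) → Set (ComplexTorus Φ) := fun o ↦ o.elim Y fun j ↦ (fun x ↦ x + τ j) ⁻¹' D j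
    with hFdef
  have hFeq : (⋂ o ∈ (Finset.univ : Finset (Option (Fin k))), F o) = Y ∩ ⋂ j, (fun x ↦ x + τ j) ⁻¹' D j := by
    ext x
    simp only [mem_iInter, Finset.mem_univ, forall_true_left, Option.forall, hFdef, Option.elim, mem_inter_iff]
  have hF : ∀ o ∈ (Finset.univ : Finset (Option (Fin k))), HasPureCodim 𝓘(ℂ, E) (F o) (Option.elim o cY fun _ ↦ 1) := by
    rintro (_ | j) -
    · exact hYc
    · change HasPureCodim 𝓘(ℂ, E) ((fun x ↦ x + τ j) ⁻¹' D j) 1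
      obtain ⟨c', hc', h'⟩ := hasPureDim_preimage_add_right Φ (hD j) (τ j)
      rwa [show c' = 1 by omega] at h'
  have h := HasPureCodim.codim_le_sum_of_isRegularPointOfCodim_biInter Finset.univ hF
    (by rw [hFeq]; exact hy) (by rw [hFeq]; exact hc)
  have h' : c ≤ cY + k := by simpa [Fintype.sum_option] using h
  omega

omit [DecidableEq ι] [MeasurableSpace E] [BorelSpace E] in
/-- **Every irreducible component of `Z(τ) = Y ∩ ⋂_j (D_j − τ_j)` has pure dimension `m ≥ dim Y − k`** (and
`m ≤ g`): a component is the closure of a connected component of `reg Z(τ)` through a regular point, whose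
codimension is `≤ codim Y + k`. The components with `m = dim Y − k` are the PROPER components, the others are
the EXCESS components. [cite: Chirka1989, §3.5 Prop. 3 (p. 37), §12.1 (p. 136) and §5.4 Thm. (p. 57)] [cite: Fulton1998, §7.1 Def. 7.1] -/
theorem exists_hasPureDim_of_isIrreducibleComponent_inter_iInter_translate {q : ℕ} (hq1 : q + 1 = finrank ℂ E)
    {k d : ℕ} {Y : Set (ComplexTorus Φ)} (hY : HasPureDim 𝓘(ℂ, E) Y d)
    {D : Fin k → Set (ComplexTorus Φ)} (hD : ∀ j, HasPureDim 𝓘(ℂ, E) (D j) q) (τ : Fin k → ComplexTorus Φ)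
    {C : Set (ComplexTorus Φ)} (hC : IsIrreducibleComponent 𝓘(ℂ, E) (Y ∩ ⋂ j, (fun x ↦ x + τ j) ⁻¹' D j) C) :
    ∃ m, d ≤ m + k ∧ m ≤ finrank ℂ E ∧ HasPureDim 𝓘(ℂ, E) C m := by
  have hZan := isAnalyticSet_inter_iInter_translate Φ hY hD τ
  have hdg : d ≤ finrank ℂ E := hY.le_finrank
  obtain ⟨c', hc', hCc'⟩ := hZan.exists_hasPureCodim_le_of_isIrreducibleComponent (N := finrank ℂ E + k - d)
    (fun y hy c hc ↦ by
      have := codim_le_of_isRegularPointOfCodim_inter_iInter_translate Φ hq1 hY hD τ hy hc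
      omega) hC
  have hc'g : c' ≤ finrank ℂ E := by
    obtain ⟨y, hy⟩ := IsAnalyticSet.nonempty_regularLocus hCc'.1 hCc'.2.1
    exact (hCc'.2.2 y hy).le_finrank
  exact ⟨finrank ℂ E - c', by omega, Nat.sub_le _ _, hCc'.hasPureDim hc'g⟩

omit [DecidableEq ι] [MeasurableSpace E] [BorelSpace E] in
/-- **A non-empty closed analytic subset of the torus all of whose irreducible components have pure dimension `m`
has pure dimension `m`** (it is the finite union of its components). [cite: Chirka1989, §5.4 Thm. (2), p. 57] -/
theorem hasPureDim_of_forall_isIrreducibleComponent {Z : Set (ComplexTorus Φ)} (hZ : IsAnalyticSet 𝓘(ℂ, E) Z)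
    (hne : Z.Nonempty) {m : ℕ} (hcomp : ∀ C, IsIrreducibleComponent 𝓘(ℂ, E) Z C → HasPureDim 𝓘(ℂ, E) C m) :
    HasPureDim 𝓘(ℂ, E) Z m := by
  classical
  have hfin := finite_isIrreducibleComponent Φ hZ
  -- `Z` is the union of its components
  have hZeq : Z = ⋃ C ∈ hfin.toFinset, C := by
    refine Subset.antisymm (fun x hx ↦ ?_) (iUnion₂_subset fun C hC ↦ (hfin.mem_toFinset.1 hC).subset)
    obtain ⟨C, hC, hxC⟩ := (isIrreducibleAnalyticSet_singleton (I := 𝓘(ℂ, E)) x)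
      |>.exists_isIrreducibleComponent_superset hZ (singleton_subset_iff.2 hx)
    exact mem_biUnion (hfin.mem_toFinset.2 hC) (singleton_subset_iff.1 hxC)
  -- a finite union of sets of pure dimension `m` is empty or of pure dimension `m`
  have key : ∀ F : Finset (Set (ComplexTorus Φ)), (∀ W ∈ F, HasPureDim 𝓘(ℂ, E) W m) →
      (⋃ W ∈ F, W) = ∅ ∨ HasPureDim 𝓘(ℂ, E) (⋃ W ∈ F, W) m := by
    intro F hF
    induction F using Finset.induction_on with
    | empty => exact Or.inl (by simp)
    | insert W F hW ih =>
      rw [Finset.set_biUnion_insert]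
      have hWm := hF W (Finset.mem_insert_self W F)
      rcases ih (fun W' hW' ↦ hF W' (Finset.mem_insert_of_mem hW')) with h0 | hp
      · rw [h0, union_empty]
        exact Or.inr hWm
      · exact Or.inr (hWm.union hp)
  rcases key hfin.toFinset (fun W hW ↦ hcomp W (hfin.mem_toFinset.1 hW)) with h0 | hp
  · exfalso
    rw [← hZeq] at h0
    exact hne.ne_empty h0
  · rwa [← hZeq] at hp

omit [DecidableEq ι] [MeasurableSpace E] [BorelSpace E] in
/-- **PROPERNESS CRITERION: `Z(τ)` is proper iff it has no excess component.** `Z(τ) = Y ∩ ⋂_j (D_j − τ_j)` is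
empty or of the expected pure dimension `r + 1 = dim Y − k` if and only if every irreducible component of
`Z(τ)` has pure dimension `r + 1` (components always have dimension `≥ r + 1`).
[cite: Chirka1989, §3.5 Prop. 3 (p. 37), §5.4 Thm. (p. 57) and §12.1 (p. 136)] [cite: Fulton1998, §7.1 Def. 7.1] -/
theorem inter_iInter_translate_eq_empty_or_hasPureDim_iff_forall_isIrreducibleComponent {q : ℕ}
    {k d r : ℕ} {Y : Set (ComplexTorus Φ)} (hY : HasPureDim 𝓘(ℂ, E) Y d)
    {D : Fin k → Set (ComplexTorus Φ)} (hD : ∀ j, HasPureDim 𝓘(ℂ, E) (D j) q) (τ : Fin k → ComplexTorus Φ) :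
    (Y ∩ ⋂ j, (fun x ↦ x + τ j) ⁻¹' D j = ∅ ∨
      HasPureDim 𝓘(ℂ, E) (Y ∩ ⋂ j, (fun x ↦ x + τ j) ⁻¹' D j) (r + 1)) ↔
      ∀ C, IsIrreducibleComponent 𝓘(ℂ, E) (Y ∩ ⋂ j, (fun x ↦ x + τ j) ⁻¹' D j) C →
        HasPureDim 𝓘(ℂ, E) C (r + 1) := by
  constructor
  · rintro (h0 | hZ) C hC
    · exfalso
      obtain ⟨z, hz⟩ := hC.nonempty
      have := hC.subset hz
      rw [h0] at this
      exact this
    · exact hC.hasPureDim hZ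
  · intro h
    by_cases hne : (Y ∩ ⋂ j, (fun x ↦ x + τ j) ⁻¹' D j).Nonempty
    · exact Or.inr (hasPureDim_of_forall_isIrreducibleComponent Φ (isAnalyticSet_inter_iInter_translate Φ hY hD τ)
        hne h)
    · exact Or.inl (not_nonempty_iff_eq_empty.1 hne)

omit [DecidableEq ι] [MeasurableSpace E] [BorelSpace E] in
/-- **An excess component has dimension `> r + 1`**: a component of `Z(τ)` which is not of pure dimension
`r + 1 = dim Y − k` has pure dimension `m` with `r + 1 < m ≤ g`. [cite: Chirka1989, §3.5 Prop. 3 (p. 37) and §5.4 Thm. (p. 57)]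
[cite: Fulton1998, §7.1 Def. 7.1] -/
theorem exists_hasPureDim_lt_of_isIrreducibleComponent_of_not_hasPureDim {q : ℕ} (hq1 : q + 1 = finrank ℂ E)
    {k d r : ℕ} (hr : r + 1 + k = d) {Y : Set (ComplexTorus Φ)} (hY : HasPureDim 𝓘(ℂ, E) Y d)
    {D : Fin k → Set (ComplexTorus Φ)} (hD : ∀ j, HasPureDim 𝓘(ℂ, E) (D j) q) (τ : Fin k → ComplexTorus Φ)
    {C : Set (ComplexTorus Φ)} (hC : IsIrreducibleComponent 𝓘(ℂ, E) (Y ∩ ⋂ j, (fun x ↦ x + τ j) ⁻¹' D j) C)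
    (hnot : ¬ HasPureDim 𝓘(ℂ, E) C (r + 1)) :
    ∃ m, r + 1 < m ∧ m ≤ finrank ℂ E ∧ HasPureDim 𝓘(ℂ, E) C m := by
  obtain ⟨m, hdm, hmg, hCm⟩ := exists_hasPureDim_of_isIrreducibleComponent_inter_iInter_translate Φ hq1 hY hD τ hC
  refine ⟨m, ?_, hmg, hCm⟩
  rcases (show r + 1 ≤ m by omega).eq_or_lt with h | h
  · exfalso
    rw [← h] at hCm
    exact hnot hCm
  · exact h

/-! ### §2 Every component of the Fulton cycle is a proper component or lies in an excess component -/

/-- **STRUCTURE OF THE FULTON CYCLE.** For `Y` of pure dimension `r + 1 + k`, hypersurfaces `D_j` and any `τ`,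
the effective `(r+1)`-cycle `R` of file 19 (`|R| ⊆ Z(τ)`, `sign(e)^k · [Y] ∧ [D₀] ∧ ⋯ ∧ [D_{k−1}] = cl(R)`, every
proper component of `Z(τ)` a component of `R` with multiplicity `≥ 1`) has the following structure: EVERY
component `W` of `R` (`R.mult W ≠ 0`) is either a PROPER component of `Z(τ)`, or is contained in an EXCESS
component `C'` of `Z(τ)` (an irreducible component of pure dimension `m > r + 1`). Indeed the irreducible
`(r+1)`-dimensional `W ⊆ Z(τ)` lies in some component `C'`, of pure dimension `m ≥ r + 1` (§1); if
`m = r + 1` then `W = C'`. (Fulton: the distinguished varieties of the intersection lie in its irreducible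
components, and "each irreducible component of `⋂ V_i` appears as a distinguished variety".)
[cite: Fulton1998, §7.1 Prop. 7.1 (a) and §12.2 Cor. 12.2 (a), Example 12.2.1 (a)] [cite: Chirka1989, §5.3 Cor. 1 (p. 55) and §5.4 Thm. (p. 57)] -/
theorem exists_effectiveCycle_smul_wedge_wedgeFamily_eq_chainCycleClass_forall_mult_ne_zero {q : ℕ}
    (hq : 2 * q + 2 * 1 = n) (k : ℕ) {d p p' r : ℕ} (hk : 2 * d + 2 * p = n) (hp' : p + k = p')
    (hr : r + 1 + k = d) {Y : Set (ComplexTorus Φ)} (hY : HasPureDim 𝓘(ℂ, E) Y d)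
    {D : Fin k → Set (ComplexTorus Φ)} (hD : ∀ j, HasPureDim 𝓘(ℂ, E) (D j) q) (τ : Fin k → ComplexTorus Φ) :
    ∃ R : HolomorphicChain 𝓘(ℂ, E) (ComplexTorus Φ) (r + 1), (∀ W, 0 ≤ R.mult W) ∧
      R.support ⊆ Y ∩ ⋂ j, (fun x ↦ x + τ j) ⁻¹' D j ∧
      (∀ C, IsIrreducibleComponent 𝓘(ℂ, E) (Y ∩ ⋂ j, (fun x ↦ x + τ j) ⁻¹' D j) C →
        HasPureDim 𝓘(ℂ, E) C (r + 1) → IsIrreducibleComponent 𝓘(ℂ, E) R.support C ∧ 1 ≤ R.mult C) ∧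
      (∀ W, R.mult W ≠ 0 →
        (IsIrreducibleComponent 𝓘(ℂ, E) (Y ∩ ⋂ j, (fun x ↦ x + τ j) ⁻¹' D j) W ∧ HasPureDim 𝓘(ℂ, E) W (r + 1)) ∨
        ∃ C' : Set (ComplexTorus Φ), ∃ m, IsIrreducibleComponent 𝓘(ℂ, E) (Y ∩ ⋂ j, (fun x ↦ x + τ j) ⁻¹' D j) C' ∧
          HasPureDim 𝓘(ℂ, E) C' m ∧ r + 1 < m ∧ W ⊆ C') ∧
        (orientationSign Φ e : ℂ) ^ k •
            ((analyticCycleClass Φ e hk hY).wedge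
                (wedgeFamily k fun j ↦ analyticCycleClass Φ e hq (hD j))).domDomCongr
              (finCongr (by omega : 2 * p + 2 * k = 2 * p')) =
          chainCycleClass Φ e (by omega : 2 * (r + 1) + 2 * p' = n) R := by
  have hng : finrank ℂ E * 2 = n := finrank_complex_mul_two Φ e
  have hq1 : q + 1 = finrank ℂ E := by omega
  obtain ⟨R, hR0, hRs, -, hprop, hRcl⟩ :=
    exists_effectiveCycle_smul_wedge_wedgeFamily_eq_chainCycleClass_forall_one_le_mult Φ e hq k hk hp' hr hY hD τ
  refine ⟨R, hR0, hRs, hprop, fun W hW ↦ ?_, hRcl⟩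
  have hZan := isAnalyticSet_inter_iInter_translate Φ hY hD τ
  have hWirr := R.isIrreducibleAnalyticSet_of_mult_ne_zero hW
  have hWdim := R.hasPureDim_of_mult_ne_zero hW
  have hWZ : W ⊆ Y ∩ ⋂ j, (fun x ↦ x + τ j) ⁻¹' D j := (HolomorphicChain.subset_support hW).trans hRs
  obtain ⟨C', hC', hWC'⟩ := hWirr.exists_isIrreducibleComponent_superset hZan hWZ
  by_cases hC'dim : HasPureDim 𝓘(ℂ, E) C' (r + 1)
  · -- same dimension: `W = C'` is a proper component
    left
    have hWC : W = C' :=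
      hC'.isIrreducibleAnalyticSet.eq_of_subset_of_hasPureCodim hC'dim.hasPureCodim hWdim.hasPureCodim hWC'
    rw [hWC]
    exact ⟨hC', hC'dim⟩
  · right
    obtain ⟨m, hm, -, hC'm⟩ :=
      exists_hasPureDim_lt_of_isIrreducibleComponent_of_not_hasPureDim Φ hq1 hr hY hD τ hC' hC'dim
    exact ⟨C', m, hC', hC'm, hm, hWC'⟩

/-- **No excess component ⇒ the Fulton cycle has support `Z(τ)` and its components are exactly the components
of `Z(τ)`, each with multiplicity `≥ 1`** (file 8 for proper `Z(τ)`, recovered from the structure theorem).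
[cite: Fulton1998, §7.1 Prop. 7.1 (a) and §12.2 Cor. 12.2 (a)] [cite: Chirka1989, §16.1 Prop. 1 (p. 206)] -/
theorem exists_effectiveCycle_support_eq_of_forall_isIrreducibleComponent_hasPureDim {q : ℕ}
    (hq : 2 * q + 2 * 1 = n) (k : ℕ) {d p p' r : ℕ} (hk : 2 * d + 2 * p = n) (hp' : p + k = p')
    (hr : r + 1 + k = d) {Y : Set (ComplexTorus Φ)} (hY : HasPureDim 𝓘(ℂ, E) Y d)
    {D : Fin k → Set (ComplexTorus Φ)} (hD : ∀ j, HasPureDim 𝓘(ℂ, E) (D j) q) (τ : Fin k → ComplexTorus Φ)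
    (hproper : ∀ C, IsIrreducibleComponent 𝓘(ℂ, E) (Y ∩ ⋂ j, (fun x ↦ x + τ j) ⁻¹' D j) C →
      HasPureDim 𝓘(ℂ, E) C (r + 1)) :
    ∃ R : HolomorphicChain 𝓘(ℂ, E) (ComplexTorus Φ) (r + 1), (∀ W, 0 ≤ R.mult W) ∧
      R.support = Y ∩ ⋂ j, (fun x ↦ x + τ j) ⁻¹' D j ∧
      (∀ W, R.mult W ≠ 0 ↔ IsIrreducibleComponent 𝓘(ℂ, E) (Y ∩ ⋂ j, (fun x ↦ x + τ j) ⁻¹' D j) W) ∧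
      (∀ C, IsIrreducibleComponent 𝓘(ℂ, E) (Y ∩ ⋂ j, (fun x ↦ x + τ j) ⁻¹' D j) C → 1 ≤ R.mult C) ∧
        (orientationSign Φ e : ℂ) ^ k •
            ((analyticCycleClass Φ e hk hY).wedge
                (wedgeFamily k fun j ↦ analyticCycleClass Φ e hq (hD j))).domDomCongr
              (finCongr (by omega : 2 * p + 2 * k = 2 * p')) =
          chainCycleClass Φ e (by omega : 2 * (r + 1) + 2 * p' = n) R := by
  obtain ⟨R, hR0, hRs, hprop, hstruct, hRcl⟩ :=
    exists_effectiveCycle_smul_wedge_wedgeFamily_eq_chainCycleClass_forall_mult_ne_zero Φ e hq k hk hp' hr hY hD τ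
  have hZan := isAnalyticSet_inter_iInter_translate Φ hY hD τ
  -- every component of `R` is a proper component (there is no excess component)
  have hcomp : ∀ W, R.mult W ≠ 0 → IsIrreducibleComponent 𝓘(ℂ, E) (Y ∩ ⋂ j, (fun x ↦ x + τ j) ⁻¹' D j) W := by
    intro W hW
    rcases hstruct W hW with ⟨hWc, -⟩ | ⟨C', m, hC', hC'm, hm, -⟩
    · exact hWc
    · exfalso
      obtain ⟨c₁, hc₁, h₁⟩ := hproper C' hC'
      obtain ⟨c₂, hc₂, h₂⟩ := hC'm
      obtain ⟨y, hy⟩ := IsAnalyticSet.nonempty_regularLocus h₁.1 h₁.2.1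
      have := (h₁.2.2 y hy).codim_unique hy.1 (h₂.2.2 y hy)
      omega
  refine ⟨R, hR0, hRs.antisymm fun x hx ↦ ?_, fun W ↦ ⟨hcomp W, fun hW ↦ ?_⟩,
    fun C hC ↦ (hprop C hC (hproper C hC)).2, hRcl⟩
  · -- `Z(τ) ⊆ |R|`: every point lies on a component, which is proper, hence on `|R|`
    obtain ⟨C, hC, hxC⟩ := (isIrreducibleAnalyticSet_singleton (I := 𝓘(ℂ, E)) x)
      |>.exists_isIrreducibleComponent_superset hZan (singleton_subset_iff.2 hx)
    exact (hprop C hC (hproper C hC)).1.subset (singleton_subset_iff.1 hxC)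
  · have h1 := (hprop W hW (hproper W hW)).2
    omega

/-! ### §3 The static case `τ = 0`: translate-free statements about `Y ∩ ⋂_j D_j` -/

omit [DecidableEq ι] [MeasurableSpace E] [BorelSpace E] in
/-- **Every irreducible component of `Y ∩ ⋂_j D_j` has pure dimension `m ≥ dim Y − k`** (static `τ = 0`).
[cite: Chirka1989, §3.5 Prop. 3 (p. 37), §12.1 (p. 136) and §5.4 Thm. (p. 57)] -/
theorem exists_hasPureDim_of_isIrreducibleComponent_inter_iInter {q : ℕ} (hq1 : q + 1 = finrank ℂ E)
    {k d : ℕ} {Y : Set (ComplexTorus Φ)} (hY : HasPureDim 𝓘(ℂ, E) Y d)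
    {D : Fin k → Set (ComplexTorus Φ)} (hD : ∀ j, HasPureDim 𝓘(ℂ, E) (D j) q)
    {C : Set (ComplexTorus Φ)} (hC : IsIrreducibleComponent 𝓘(ℂ, E) (Y ∩ ⋂ j, D j) C) :
    ∃ m, d ≤ m + k ∧ m ≤ finrank ℂ E ∧ HasPureDim 𝓘(ℂ, E) C m := by
  rw [← inter_iInter_translate_zero₂₂ Φ Y D] at hC
  exact exists_hasPureDim_of_isIrreducibleComponent_inter_iInter_translate Φ hq1 hY hD 0 hC

omit [DecidableEq ι] [MeasurableSpace E] [BorelSpace E] in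
/-- **`Y ∩ ⋂_j D_j` is proper iff it has no excess component** (static `τ = 0`).
[cite: Chirka1989, §3.5 Prop. 3 (p. 37) and §5.4 Thm. (p. 57)] [cite: Fulton1998, §7.1 Def. 7.1] -/
theorem inter_iInter_eq_empty_or_hasPureDim_iff_forall_isIrreducibleComponent {q : ℕ}
    {k d r : ℕ} {Y : Set (ComplexTorus Φ)} (hY : HasPureDim 𝓘(ℂ, E) Y d)
    {D : Fin k → Set (ComplexTorus Φ)} (hD : ∀ j, HasPureDim 𝓘(ℂ, E) (D j) q) :
    (Y ∩ ⋂ j, D j = ∅ ∨ HasPureDim 𝓘(ℂ, E) (Y ∩ ⋂ j, D j) (r + 1)) ↔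
      ∀ C, IsIrreducibleComponent 𝓘(ℂ, E) (Y ∩ ⋂ j, D j) C → HasPureDim 𝓘(ℂ, E) C (r + 1) := by
  rw [← inter_iInter_translate_zero₂₂ Φ Y D]
  exact inter_iInter_translate_eq_empty_or_hasPureDim_iff_forall_isIrreducibleComponent Φ hY hD 0

/-- **PROPER COMPONENTS OF `Y ∩ ⋂_j D_j` ARE COMPONENTS OF THE FULTON CYCLE** (file 19 §2 at `τ = 0`): there is
an effective `(r+1)`-cycle `R` on `Y ∩ ⋂_j D_j` with `sign(e)^k · [Y] ∧ [D₀] ∧ ⋯ ∧ [D_{k−1}] = cl(R)` having every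
proper component of `Y ∩ ⋂_j D_j` as a component with multiplicity `≥ 1`, and every component of `R` a proper
component or inside an excess component. [cite: Fulton1998, §7.1 Prop. 7.1 (a) and §12.2 Cor. 12.2 (a), Example 12.2.1 (a)]
[cite: Lange2023AbelianVarietiesComplex, §4.6.2 p. 235] -/
theorem exists_effectiveCycle_smul_wedge_wedgeFamily_eq_chainCycleClass_inter_iInter_forall_one_le_mult {q : ℕ}
    (hq : 2 * q + 2 * 1 = n) (k : ℕ) {d p p' r : ℕ} (hk : 2 * d + 2 * p = n) (hp' : p + k = p')
    (hr : r + 1 + k = d) {Y : Set (ComplexTorus Φ)} (hY : HasPureDim 𝓘(ℂ, E) Y d)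
    {D : Fin k → Set (ComplexTorus Φ)} (hD : ∀ j, HasPureDim 𝓘(ℂ, E) (D j) q) :
    ∃ R : HolomorphicChain 𝓘(ℂ, E) (ComplexTorus Φ) (r + 1), (∀ W, 0 ≤ R.mult W) ∧
      R.support ⊆ Y ∩ ⋂ j, D j ∧
      (∀ C, IsIrreducibleComponent 𝓘(ℂ, E) (Y ∩ ⋂ j, D j) C →
        HasPureDim 𝓘(ℂ, E) C (r + 1) → IsIrreducibleComponent 𝓘(ℂ, E) R.support C ∧ 1 ≤ R.mult C) ∧
      (∀ W, R.mult W ≠ 0 →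
        (IsIrreducibleComponent 𝓘(ℂ, E) (Y ∩ ⋂ j, D j) W ∧ HasPureDim 𝓘(ℂ, E) W (r + 1)) ∨
        ∃ C' : Set (ComplexTorus Φ), ∃ m, IsIrreducibleComponent 𝓘(ℂ, E) (Y ∩ ⋂ j, D j) C' ∧
          HasPureDim 𝓘(ℂ, E) C' m ∧ r + 1 < m ∧ W ⊆ C') ∧
        (orientationSign Φ e : ℂ) ^ k •
            ((analyticCycleClass Φ e hk hY).wedge
                (wedgeFamily k fun j ↦ analyticCycleClass Φ e hq (hD j))).domDomCongr
              (finCongr (by omega : 2 * p + 2 * k = 2 * p')) =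
          chainCycleClass Φ e (by omega : 2 * (r + 1) + 2 * p' = n) R := by
  have h := exists_effectiveCycle_smul_wedge_wedgeFamily_eq_chainCycleClass_forall_mult_ne_zero Φ e hq k hk hp' hr
    hY hD 0
  rwa [inter_iInter_translate_zero₂₂ Φ Y D] at h

/-- **`#{proper components of Y ∩ ⋂_j D_j} ≤ (L^{r+1} · Y · D₀ ⋯ D_{k−1})`** on a polarised complex torus
(file 19 §3 at `τ = 0`): Bézout for the proper components of an ARBITRARY configuration of a subvariety and
`k` hypersurfaces. [cite: Fulton1998, §8.4 Example 8.4.6 and §12.2 Cor. 12.2 (a), Example 12.2.1 (a)]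
[cite: deJong1993AmpleLineBundles, Ch. VII §4 Thm. 4.3.1] -/
theorem IsRiemannForm.ncard_properComponent_inter_iInter_le_re_poincarePairing {q : ℕ}
    (hq : 2 * q + 2 * 1 = n) (k : ℕ) {d p p' r : ℕ} (hk : 2 * d + 2 * p = n) (hp' : p + k = p')
    (hr : r + 1 + k = d) {Y : Set (ComplexTorus Φ)} (hY : HasPureDim 𝓘(ℂ, E) Y d)
    {D : Fin k → Set (ComplexTorus Φ)} (hD : ∀ j, HasPureDim 𝓘(ℂ, E) (D j) q)
    {η : E [⋀^Fin 2]→L[ℝ] ℝ} (hη : IsRiemannForm Φ η) :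
    (({C : Set (ComplexTorus Φ) | IsIrreducibleComponent 𝓘(ℂ, E) (Y ∩ ⋂ j, D j) C ∧
          HasPureDim 𝓘(ℂ, E) C (r + 1)}.ncard : ℕ) : ℝ) ≤
      (poincarePairing Φ e (by omega : 2 * (r + 1) + 2 * p' = n) (wedgePow (ofRealForm (-η)) (r + 1))
        ((orientationSign Φ e : ℂ) ^ k •
          ((analyticCycleClass Φ e hk hY).wedge
              (wedgeFamily k fun j ↦ analyticCycleClass Φ e hq (hD j))).domDomCongr
            (finCongr (by omega : 2 * p + 2 * k = 2 * p')))).re := by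
  have h := hη.ncard_properComponent_le_re_poincarePairing Φ e hq k hk hp' hr hY hD 0
  rwa [inter_iInter_translate_zero₂₂ Φ Y D] at h

/-- **There is `m = (L^{r+1} · Y · D₀ ⋯ D_{k−1}) ∈ ℕ` with `#{proper components of Y ∩ ⋂_j D_j} ≤ m`.**
[cite: Fulton1998, §8.4 Example 8.4.6 and §12.2 Cor. 12.2 (a)] [cite: deJong1993AmpleLineBundles, Ch. VII §4 Thm. 4.3.1] -/
theorem IsRiemannForm.exists_nat_poincarePairing_eq_and_ncard_properComponent_inter_iInter_le {q : ℕ}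
    (hq : 2 * q + 2 * 1 = n) (k : ℕ) {d p p' r : ℕ} (hk : 2 * d + 2 * p = n) (hp' : p + k = p')
    (hr : r + 1 + k = d) {Y : Set (ComplexTorus Φ)} (hY : HasPureDim 𝓘(ℂ, E) Y d)
    {D : Fin k → Set (ComplexTorus Φ)} (hD : ∀ j, HasPureDim 𝓘(ℂ, E) (D j) q)
    {η : E [⋀^Fin 2]→L[ℝ] ℝ} (hη : IsRiemannForm Φ η) :
    ∃ m : ℕ, poincarePairing Φ e (by omega : 2 * (r + 1) + 2 * p' = n) (wedgePow (ofRealForm (-η)) (r + 1))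
        ((orientationSign Φ e : ℂ) ^ k •
          ((analyticCycleClass Φ e hk hY).wedge
              (wedgeFamily k fun j ↦ analyticCycleClass Φ e hq (hD j))).domDomCongr
            (finCongr (by omega : 2 * p + 2 * k = 2 * p'))) = m ∧
      {C : Set (ComplexTorus Φ) | IsIrreducibleComponent 𝓘(ℂ, E) (Y ∩ ⋂ j, D j) C ∧
          HasPureDim 𝓘(ℂ, E) C (r + 1)}.ncard ≤ m := by
  obtain ⟨m, hm, h⟩ := hη.exists_nat_poincarePairing_eq_and_forall_ncard_properComponent_le Φ e hq k hk hp' hr hY hD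
  refine ⟨m, hm, ?_⟩
  have h0 := h 0
  rwa [inter_iInter_translate_zero₂₂ Φ Y D] at h0

/-- **Equality in Bézout for a proper `Y ∩ ⋂_j D_j`** (file 20 §2 at `τ = 0`): if `Y ∩ ⋂_j D_j` is empty or of
pure dimension `r + 1` and `(L^{r+1} · Y · D₀ ⋯ D_{k−1}) ≤ #{components}`, then
`sign(e)^k · [Y] ∧ [D₀] ∧ ⋯ ∧ [D_{k−1}] = [Y ∩ ⋂_j D_j]` (multiplicity one) and the intersection number equals the
number of components. [cite: Fulton1998, §8.2 Prop. 8.2 (c), §8.4 (1) and Example 8.4.6]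
[cite: deJong1993AmpleLineBundles, Ch. VII §4 Thm. 4.3.1] -/
theorem IsRiemannForm.smul_wedge_wedgeFamily_eq_setCycleClass_inter_iInter_of_re_poincarePairing_le_ncard {q : ℕ}
    (hq : 2 * q + 2 * 1 = n) (k : ℕ) {d p p' r : ℕ} (hk : 2 * d + 2 * p = n) (hp' : p + k = p')
    (hr : r + 1 + k = d) {Y : Set (ComplexTorus Φ)} (hY : HasPureDim 𝓘(ℂ, E) Y d)
    {D : Fin k → Set (ComplexTorus Φ)} (hD : ∀ j, HasPureDim 𝓘(ℂ, E) (D j) q)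
    (hZ : Y ∩ ⋂ j, D j = ∅ ∨ HasPureDim 𝓘(ℂ, E) (Y ∩ ⋂ j, D j) (r + 1))
    {η : E [⋀^Fin 2]→L[ℝ] ℝ} (hη : IsRiemannForm Φ η)
    (hle : (poincarePairing Φ e (by omega : 2 * (r + 1) + 2 * p' = n) (wedgePow (ofRealForm (-η)) (r + 1))
        ((orientationSign Φ e : ℂ) ^ k •
          ((analyticCycleClass Φ e hk hY).wedge
              (wedgeFamily k fun j ↦ analyticCycleClass Φ e hq (hD j))).domDomCongr
            (finCongr (by omega : 2 * p + 2 * k = 2 * p')))).re ≤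
      {C : Set (ComplexTorus Φ) | IsIrreducibleComponent 𝓘(ℂ, E) (Y ∩ ⋂ j, D j) C}.ncard) :
    (orientationSign Φ e : ℂ) ^ k •
          ((analyticCycleClass Φ e hk hY).wedge
              (wedgeFamily k fun j ↦ analyticCycleClass Φ e hq (hD j))).domDomCongr
            (finCongr (by omega : 2 * p + 2 * k = 2 * p')) =
        setCycleClass Φ e (by omega : 2 * (r + 1) + 2 * p' = n) (Y ∩ ⋂ j, D j) ∧
      poincarePairing Φ e (by omega : 2 * (r + 1) + 2 * p' = n) (wedgePow (ofRealForm (-η)) (r + 1))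
        ((orientationSign Φ e : ℂ) ^ k •
          ((analyticCycleClass Φ e hk hY).wedge
              (wedgeFamily k fun j ↦ analyticCycleClass Φ e hq (hD j))).domDomCongr
            (finCongr (by omega : 2 * p + 2 * k = 2 * p'))) =
        ({C : Set (ComplexTorus Φ) | IsIrreducibleComponent 𝓘(ℂ, E) (Y ∩ ⋂ j, D j) C}.ncard : ℕ) := by
  rw [← inter_iInter_translate_zero₂₂ Φ Y D] at hZ hle ⊢
  exact hη.smul_wedge_wedgeFamily_eq_setCycleClass_of_re_poincarePairing_le_ncard Φ e hq k hk hp' hr hY hD 0 hZ hle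

end ComplexTorus

end Literature.Geometry.Kaehler

end
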